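import Literature.AlgebraicGeometry.Limits.SmoothProjectiveSpreadBirational
import Literature.AlgebraicGeometry.HodgeTheory.QuaternionicQuarticFamily
import Literature.AlgebraicGeometry.Resolution.SmoothGeometricallyIrreducibleResolution
import Literature.AlgebraicGeometry.Resolution.BirationalDimensionInequality
import Literature.AlgebraicGeometry.Motives.VarietiesDimensionProofs
import Literature.AlgebraicGeometry.Motives.AbelianVarietyProofs
import Literature.AlgebraicGeometry.Motives.SpecialisedHypersurfaceFamily
import Literature.AlgebraicGeometry.HodgeTheory.SpecialisedHypersurfaceFamilyPoints
import Literature.AlgebraicGeometry.HodgeTheory.SpreadingOutQbarFamilyProofs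
import Literature.AlgebraicGeometry.Morphisms.IsoOverOpen
import Mathlib.AlgebraicGeometry.Birational.Birational
import HarnessLib

/-!
# «Q-FAMILY» from a cover: the quaternionic quartic planes in ONE smooth projective family
# (assembly step QF-5b of the programme; EGA IV₃ §8 + Hironaka over `ℂ(a)`)

Layer `Literature/AlgebraicGeometry/HodgeTheory`; PROOF file (no definitions, no named facts). Programme
«Q-FAMILY» of the cell `hodge-nonav` (prover seat `prover-Bx` g18; memo `PROGRAMME-Q-FAMILY-Bx-g18.md` §6–§7)
for route `HodgeConjecture/Q8SymplecticPowers` (crux K1Q, `stmt-HodgeConjecture-24190`).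

`qFamily_of_cover` reduces the statement `Q8Family.QFamily e` (`QuaternionicQuarticFamily.lean`: a smooth
projective family of relative dimension `2` over a non-empty open `W ⊆ 𝔸^{CIdx e}` with quasi-projective total
space and smooth quasi-projective base, fibrewise birational over `ℂ` to the reduced quartic surfaces
`V(x₃⁴x₂^{2e} − c(σc)³((x₀−x₁)ψ)²)`) to three properties («C1–C3») of ANY `A`-scheme `P → Spec A`,
`A = ℂ[a] = MvPolynomial (CIdx e) ℂ` (the «cover», to be the universal quaternionic quartic `𝒱 ⊂ ℙ³_A`):
(C1) `P → Spec A` quasi-compact, quasi-separated, locally of finite presentation; (C2) the generic fibre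
`P_K = P ×_A Spec K`, `K = Frac A`, is integral, projective over `K`, geometrically irreducible, of dimension
`2`; (C3) a non-zero `G ∈ A` such that over every coefficient vector `a ∈ ℂ^{CIdx e}` with `G(a) ≠ 0` the fibre
`P ×_A Spec ℂ` is irreducible and `ℂ`-isomorphic to every hypersurface cut out in `ℙ³` by the specialised
form `quarticForm e (cOf a) (ψOf a)`.

Proof (memo §7): resolve the integral projective geometrically irreducible generic fibre over the
characteristic-zero field `K` (`Resolution.exists_isResolution_smooth_geometricallyIrreducible`, from
`Hironaka1964_holds`; dimension `2` by `IsResolution.topologicalKrullDim_eq` and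
`topologicalKrullDim_eq_of_smoothOfRelativeDimension`); the isomorphism locus of the resolution is the generic
trace of an open of `P` (push-forward of the vanishing ideal sheaf, `comap_map_eq_of_isPullback_generic`),
inside which an affine open `V` is chosen; `Limits.exists_projectiveModel_birational` (QF-5a) spreads the
resolution to a projective `A`-model `Pm ⊂ ℙᴺ_A` with good reduction and fibrewise birationality to `P` away
from some `t ≠ 0`; the family is `Pm ×_A D(tG) → D(tG)`, `W = D(tG)`, with complex points the coefficient
vectors `a`, `t(a)G(a) ≠ 0` (`MvPolynomial.funext` gives one). Smoothness ∕ properness ∕ geometric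
irreducibility descend from `A[1/t]` by base change along `D(tG) ⊆ D(t) = Spec A[1/t]`; projectivity of the
fibres and quasi-projectivity of total space and base are the packaging lemmas of
`SpreadingOutQbarFamilyProofs` (`isProjectiveOver_of_isPullback_proj`,
`isQuasiProjectiveOver_of_proj_over_specOver`, `isQuasiProjectiveOver_specOver`); the birationality clause
composes `Pm_a ≅ fibre`, QF-5a (ii) at the `ℂ`-point `a`, and the `ℂ`-isomorphism of (C3) (Mathlib
`Scheme.BirationalOver.trans`, `Scheme.Hom.birationalOver`). Honest scope: an assembly lemma; (C1)–(C3)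
for the universal quaternionic quartic are separate files (QF-1b); nothing here bears on HC.

## References

* [EGAIV3] A. Grothendieck, J. Dieudonné, EGA IV₃, Publ. Math. IHÉS 28 (1966), §8.10.5, §9.7.7; EGA IV₄
  17.7.8 (spreading out from the generic fibre).
* [Kollar2007] J. Kollár, Lectures on Resolution of Singularities, Ann. of Math. Stud. 166 (2007), Thm. 3.27,
  Thm. 3.36.
* [Hartshorne1977] R. Hartshorne, Algebraic Geometry, GTM 52 (1977), II §4 (quasi-projective), III §10
  (smooth families).
-/

noncomputable section

open CategoryTheory CategoryTheory.Limits AlgebraicGeometry TopologicalSpace MvPolynomial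
  MonoidalCategory CartesianMonoidalCategory
open Literature.AlgebraicGeometry.Morphisms Literature.AlgebraicGeometry.Motives
open Literature.AlgebraicGeometry.HodgeTheory.SpreadingOutQbar
open Literature.AlgebraicGeometry.Resolution Literature.AlgebraicGeometry.Limits

namespace Literature.AlgebraicGeometry.HodgeTheory.Q8Family

/-- **«Q-FAMILY» from a cover (C1–C3).** Let `A = ℂ[a]`, `a = (a_i)_{i ∈ CIdx e}`, `K` a fraction field of
`A`, and `P → Spec A` an `A`-scheme («cover») such that: (C1) `P → Spec A` is quasi-compact, quasi-separated
and locally of finite presentation; (C2) the generic fibre `P_K` is integral, projective over `K`,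
geometrically irreducible over `K` and of (topological Krull) dimension `2`; (C3) for a non-zero `G ∈ A`, over
every `a ∈ ℂ^{CIdx e}` with `G(a) ≠ 0` the fibre `P_a = P ×_A Spec ℂ` is irreducible and isomorphic over `ℂ`
to every hypersurface cut out in `ℙ³_ℂ` by `quarticForm e (cOf a) (ψOf a)`. Then `QFamily e` holds: there is
a smooth projective family of relative dimension `2` over a non-empty open `W ⊆ 𝔸^{CIdx e}` (namely
`W = D(tG)`), with quasi-projective total space and smooth quasi-projective base, whose fibre over each
complex point `a ∈ W(ℂ)` is birational over `ℂ` to those hypersurfaces (EGA IV₃ 8.10.5, IV₄ 17.7.8 applied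
to a resolution of `P_K`, Kollár 2007 Thm. 3.27 ∕ 3.36; Hartshorne III §10).
[cite: EGAIV3, §8.10.5 and §9.7.7] [cite: Kollar2007, Thm. 3.36] -/
theorem qFamily_of_cover (e : ℕ) {K : Type} [Field K] [Algebra (MvPolynomial (CIdx e) ℂ) K]
    [IsFractionRing (MvPolynomial (CIdx e) ℂ) K]
    (P : SchemeOver (MvPolynomial (CIdx e) ℂ)) [QuasiCompact P.hom] [QuasiSeparated P.hom]
    [LocallyOfFinitePresentation P.hom]
    [IsIntegral (P ⊗ specOver (MvPolynomial (CIdx e) ℂ) K).left]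
    (hproj : IsProjectiveOver
      (Over.mk (snd P (specOver (MvPolynomial (CIdx e) ℂ) K)).left : SchemeOver K))
    [GeometricallyIrreducible (snd P (specOver (MvPolynomial (CIdx e) ℂ) K)).left]
    (hdim : topologicalKrullDim ↥(P ⊗ specOver (MvPolynomial (CIdx e) ℂ) K).left = 2)
    (G : MvPolynomial (CIdx e) ℂ) (hG : G ≠ 0)
    (hC3 : ∀ a : CIdx e → ℂ, MvPolynomial.eval a G ≠ 0 →
      IrreducibleSpace ↥(pullback P.hom (Spec.map (CommRingCat.ofHom (MvPolynomial.eval a)))) ∧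
      ∀ ⦃V : SchemeOver ℂ⦄, IsHypersurfaceCutOutBy 3 (quarticForm e (cOf a) (ψOf a)) V →
        Nonempty (V ≅ Over.mk (pullback.snd P.hom (Spec.map (CommRingCat.ofHom (MvPolynomial.eval a)))))) :
    QFamily e := by
  classical
  -- `ℙᴺ_A = Proj A[x₀..x_N]` needs the grading of `MvPolynomial` as a (local) instance
  have _iGA : ∀ {σ R : Type} [CommSemiring R], GradedAlgebra (MvPolynomial.homogeneousSubmodule σ R) :=
    @MvPolynomial.gradedAlgebra
  haveI : CharZero K :=
    charZero_of_injective_algebraMap (IsFractionRing.injective (MvPolynomial (CIdx e) ℂ) K)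
  -- ### (0) the generic fibre `X = P_K` and its resolution `ρ : Y → X` (QF-4; Hironaka over `K`)
  let X : SchemeOver K := Over.mk (snd P (specOver (MvPolynomial (CIdx e) ℂ) K)).left
  haveI : IsIntegral X.left :=
    inferInstanceAs (IsIntegral (P ⊗ specOver (MvPolynomial (CIdx e) ℂ) K).left)
  haveI : GeometricallyIrreducible X.hom :=
    inferInstanceAs (GeometricallyIrreducible (snd P (specOver (MvPolynomial (CIdx e) ℂ) K)).left)
  obtain ⟨Y, ρ, hres, hprojY, hsmY, hgiY⟩ := exists_isResolution_smooth_geometricallyIrreducible X hproj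
  let E : SchemeOver K := Over.mk (ρ ≫ X.hom)
  haveI : IsProper ρ := hres.isProper
  have hbir : IsBirational ρ := hres.isBirational
  haveI : IrreducibleSpace Y := hbir.irreducibleSpace
  haveI := hsmY
  obtain ⟨d, hd⟩ := exists_smoothOfRelativeDimension_of_smooth (ρ ≫ X.hom)
  haveI := hd
  -- `dim Y = dim X = 2`, so `d = 2`
  haveI : IsProper X.hom := IsProjectiveOver.isProper hproj
  haveI : IsLocallyNoetherian X.left := LocallyOfFiniteType.isLocallyNoetherian X.hom
  have hdimY : topologicalKrullDim Y = (d : WithBot ℕ∞) :=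
    topologicalKrullDim_eq_of_smoothOfRelativeDimension (ρ ≫ X.hom) d
  have hdimYX : topologicalKrullDim Y = topologicalKrullDim X.left := hres.topologicalKrullDim_eq
  have hd2 : d = 2 := by
    have h : ((d : ℕ∞) : WithBot ℕ∞) = ((2 : ℕ) : ℕ∞) := by
      rw [Nat.cast_ofNat]
      exact hdimY.symm.trans (hdimYX.trans hdim)
    exact_mod_cast h
  subst hd2
  have hE : IsSmoothProjective 2 E := ⟨hd, hprojY, hgiY⟩
  -- ### (1) an affine open `V ⊆ P` with non-empty generic trace inside the isomorphism locus of `ρ`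
  obtain ⟨(U' : (P ⊗ specOver (MvPolynomial (CIdx e) ℂ) K).left.Opens), -, hρU'd, hisoU'⟩ := hbir
  -- `ρ` with source spelled `E.left` (the form in which QF-5a's instance argument is stated)
  obtain ⟨ρE, hρE⟩ : ∃ ρE : E.left ⟶ (P ⊗ specOver (MvPolynomial (CIdx e) ℂ) K).left, ρE = ρ := ⟨ρ, rfl⟩
  haveI : IsIso (ρE ∣_ U') := by rw [hρE]; exact hisoU'
  have sqP : IsPullback (fst P (specOver (MvPolynomial (CIdx e) ℂ) K)).left
      (snd P (specOver (MvPolynomial (CIdx e) ℂ) K)).left P.hom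
      (Spec.map (CommRingCat.ofHom (algebraMap (MvPolynomial (CIdx e) ℂ) K))) :=
    IsPullback.of_hasPullback _ _
  have hqcK : QuasiCompact (Spec.map (CommRingCat.ofHom (algebraMap (MvPolynomial (CIdx e) ℂ) K))) :=
    inferInstance
  haveI : QuasiCompact (fst P (specOver (MvPolynomial (CIdx e) ℂ) K)).left :=
    MorphismProperty.of_isPullback sqP.flip hqcK
  -- the complement of the isomorphism locus, spread to `P`, and the open `W₀` with generic trace `U'`
  let C : Closeds ↥(P ⊗ specOver (MvPolynomial (CIdx e) ℂ) K).left := U'.compl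
  let Z : P.left.IdealSheafData :=
    (Scheme.IdealSheafData.vanishingIdeal C).map (fst P (specOver (MvPolynomial (CIdx e) ℂ) K)).left
  let W₀ : P.left.Opens := Z.support.compl
  have hW₀ : (fst P (specOver (MvPolynomial (CIdx e) ℂ) K)).left ⁻¹ᵁ W₀ = U' := by
    have h1 : Z.comap (fst P (specOver (MvPolynomial (CIdx e) ℂ) K)).left =
        Scheme.IdealSheafData.vanishingIdeal C :=
      comap_map_eq_of_isPullback_generic K P.hom sqP _
    have h2 : (Z.comap (fst P (specOver (MvPolynomial (CIdx e) ℂ) K)).left).support =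
        Z.support.preimage (fst P (specOver (MvPolynomial (CIdx e) ℂ) K)).left.continuous :=
      Scheme.IdealSheafData.support_comap Z _
    rw [h1] at h2
    apply Opens.ext
    have h3 : ((Scheme.IdealSheafData.vanishingIdeal C).support :
        Set ↥(P ⊗ specOver (MvPolynomial (CIdx e) ℂ) K).left) = C :=
      Scheme.IdealSheafData.coe_support_vanishingIdeal C
    have h4 : ((fst P (specOver (MvPolynomial (CIdx e) ℂ) K)).left ⁻¹ᵁ W₀ :
        Set ↥(P ⊗ specOver (MvPolynomial (CIdx e) ℂ) K).left) =
        ((fst P (specOver (MvPolynomial (CIdx e) ℂ) K)).left.base ⁻¹' (Z.support : Set P.left))ᶜ :=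
      rfl
    rw [h4]
    have h5 : (fst P (specOver (MvPolynomial (CIdx e) ℂ) K)).left.base ⁻¹' (Z.support : Set P.left) =
        (C : Set ↥(P ⊗ specOver (MvPolynomial (CIdx e) ℂ) K).left) := by
      rw [← h3, h2]; rfl
    rw [h5]
    exact compl_compl _
  -- a point of the isomorphism locus and an affine open of `P` around its image
  obtain ⟨y, hy⟩ := hρU'd.nonempty
  have hx : (fst P (specOver (MvPolynomial (CIdx e) ℂ) K)).left (ρ y) ∈ W₀ := by
    have h : ρ y ∈ (fst P (specOver (MvPolynomial (CIdx e) ℂ) K)).left ⁻¹ᵁ W₀ := by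
      rw [hW₀]; exact hy
    exact h
  obtain ⟨V, hVaff, hxV, hVW₀⟩ := (Opens.isBasis_iff_nbhd.mp P.left.isBasis_affineOpens) hx
  have hVc : IsCompact (V : Set P.left) := (hVaff : IsAffineOpen V).isCompact
  have hVU' : (fst P (specOver (MvPolynomial (CIdx e) ℂ) K)).left ⁻¹ᵁ V ≤ U' := by
    rw [← hW₀]
    intro z hz
    exact hVW₀ hz
  haveI : IsIso (ρE ∣_ ((fst P (specOver (MvPolynomial (CIdx e) ℂ) K)).left ⁻¹ᵁ V)) :=
    isIso_morphismRestrict_of_le ρE hVU'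
  have hVK : ((ρE ⁻¹ᵁ ((fst P (specOver (MvPolynomial (CIdx e) ℂ) K)).left ⁻¹ᵁ V) : E.left.Opens) :
      Set E.left).Nonempty := ⟨y, by rw [hρE]; exact hxV⟩
  -- ### (2) the projective model over `A`, good reduction and birationality away from `t` (QF-5a)
  have hρ : ρE ≫ (snd P (specOver (MvPolynomial (CIdx e) ℂ) K)).left = E.hom := by rw [hρE]; rfl
  obtain ⟨N, Pm, emb, hemb, gen, t, ht, HK, Hloc, Hbir⟩ :=
    exists_projectiveModel_birational (A := MvPolynomial (CIdx e) ℂ) (K := K) P hE ρE hρ V hVc hVK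
  haveI := hemb
  haveI : IsProper (ProjBaseChangeRing.projToSpec (Fin (N + 1)) (MvPolynomial (CIdx e) ℂ)) :=
    ProjBaseChangeRing.isProper_projToSpec _ _
  obtain ⟨f, hf⟩ : ∃ f : Pm ⟶ Spec (.of (MvPolynomial (CIdx e) ℂ)),
      f = emb ≫ ProjBaseChangeRing.projToSpec (Fin (N + 1)) (MvPolynomial (CIdx e) ℂ) := ⟨_, rfl⟩
  rw [← hf] at Hloc Hbir
  haveI : IsProper f := by rw [hf]; infer_instance
  -- ### (3) the base `W = D(tG)`: a coefficient vector with `t(a) G(a) ≠ 0`, and `W ⊆ D(t) = Spec A[1/t]`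
  obtain ⟨a₀, ha₀⟩ : ∃ a : CIdx e → ℂ, MvPolynomial.eval a (t * G) ≠ 0 := by
    by_contra h
    push Not at h
    exact (mul_ne_zero ht hG) (MvPolynomial.funext fun x => by rw [map_zero]; exact h x)
  let W : (Spec (.of (MvPolynomial (CIdx e) ℂ))).Opens := PrimeSpectrum.basicOpen (t * G)
  have hmemW : ∀ {L : Type} [Field L] (φ : MvPolynomial (CIdx e) ℂ →+* L) (x : Spec (.of L)),
      Spec.map (CommRingCat.ofHom φ) x ∈ W ↔ φ (t * G) ≠ 0 := by
    intro L _ φ x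
    have h : Spec.map (CommRingCat.ofHom φ) x ∈ W ↔ φ (t * G) ∉ x.asIdeal := Iff.rfl
    rw [h, Ideal.eq_bot_of_prime x.asIdeal, Ideal.mem_bot]
  -- the family `𝒳 = Pm ×_A W → W`
  let 𝒳 : SchemeOver ℂ := Over.mk (pullback.snd f W.ι ≫ (base W).hom)
  let π : 𝒳 ⟶ base W := Over.homMk (pullback.snd f W.ι) rfl
  -- `W → Spec A[1/t]` and `𝒳 → W` as a base change of `Pm ×_A Spec A[1/t] → Spec A[1/t]`
  let T : Type := Localization.Away t
  let jT : Spec (.of T) ⟶ Spec (.of (MvPolynomial (CIdx e) ℂ)) :=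
    Spec.map (CommRingCat.ofHom (algebraMap (MvPolynomial (CIdx e) ℂ) T))
  have hWT : Set.range W.ι ⊆ Set.range jT := by
    rw [Scheme.Opens.range_ι]
    change ((PrimeSpectrum.basicOpen (t * G) : Opens _) : Set _) ⊆
      Set.range (PrimeSpectrum.comap (algebraMap (MvPolynomial (CIdx e) ℂ) T))
    rw [PrimeSpectrum.localization_away_comap_range T t, PrimeSpectrum.basicOpen_mul]
    exact SetLike.coe_subset_coe.mpr inf_le_left
  let ℓ : (W : Scheme) ⟶ Spec (.of T) := IsOpenImmersion.lift jT W.ι hWT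
  have hℓ : ℓ ≫ jT = W.ι := IsOpenImmersion.lift_fac _ _ _
  let m : pullback f W.ι ⟶ pullback f jT :=
    pullback.lift (pullback.fst f W.ι) (pullback.snd f W.ι ≫ ℓ)
      (by rw [Category.assoc, hℓ]; exact pullback.condition)
  have sqT : IsPullback m (pullback.snd f W.ι) (pullback.snd f jT) ℓ := by
    have outer : IsPullback (m ≫ pullback.fst f jT) (pullback.snd f W.ι) f (ℓ ≫ jT) := by
      rw [pullback.lift_fst, hℓ]
      exact IsPullback.of_hasPullback f W.ι
    exact IsPullback.of_right outer (pullback.lift_snd _ _ _) (IsPullback.of_hasPullback f jT)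
  obtain ⟨-, hTsm, hTgi⟩ := Hloc T
  haveI : SmoothOfRelativeDimension 2 (pullback.snd f W.ι) := by
    haveI := smoothOfRelativeDimension_isStableUnderBaseChange (n := 2)
    exact MorphismProperty.of_isPullback (P := @SmoothOfRelativeDimension 2) sqT hTsm
  haveI : GeometricallyIrreducible (pullback.snd f W.ι) :=
    MorphismProperty.of_isPullback (P := @GeometricallyIrreducible) sqT hTgi
  -- ### (4) complex points of `W` are coefficient vectors `a` with `t(a) ≠ 0`, `G(a) ≠ 0`
  have hpt : ∀ s : AlgPoints (base W) ℂ,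
      s.left ≫ W.ι = Spec.map (CommRingCat.ofHom (MvPolynomial.eval (coeffs W s))) ∧
        MvPolynomial.eval (coeffs W s) t ≠ 0 ∧ MvPolynomial.eval (coeffs W s) G ≠ 0 := by
    intro s
    have hSpec : Spec.map (Spec.preimage (s.left ≫ W.ι)) = s.left ≫ W.ι := Spec.map_preimage _
    have hcomp : (Spec.preimage (s.left ≫ W.ι)).hom.comp (algebraMap ℂ (MvPolynomial (CIdx e) ℂ)) =
        algebraMap ℂ ℂ := by
      have hw : Spec.map (Spec.preimage (s.left ≫ W.ι)) ≫
          Spec.map (CommRingCat.ofHom (algebraMap ℂ (MvPolynomial (CIdx e) ℂ))) =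
            Spec.map (CommRingCat.ofHom (algebraMap ℂ ℂ)) := by
        rw [hSpec]
        exact (Category.assoc _ _ _).trans (Over.w s)
      rw [← Spec.map_comp] at hw
      have := congrArg CommRingCat.Hom.hom (Spec.map_injective hw)
      simpa using this
    have hφ : (Spec.preimage (s.left ≫ W.ι)).hom = MvPolynomial.eval (coeffs W s) := by
      refine MvPolynomial.ringHom_ext (fun r => ?_) (fun i => ?_)
      · rw [MvPolynomial.eval_C, ← MvPolynomial.algebraMap_eq]
        simpa using RingHom.congr_fun hcomp r
      · rw [MvPolynomial.eval_X]
        rfl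
    have h1 : s.left ≫ W.ι = Spec.map (CommRingCat.ofHom (MvPolynomial.eval (coeffs W s))) := by
      rw [← hφ, CommRingCat.ofHom_hom, hSpec]
    -- the point lies in `W = D(tG)`
    let x₀ : Spec (.of ℂ) := ⟨⊥, Ideal.isPrime_bot⟩
    have hx₀ : (s.left ≫ W.ι) x₀ ∈ W := by
      rw [Scheme.Hom.comp_apply]
      exact (s.left x₀ : W).2
    rw [h1] at hx₀
    have htG : MvPolynomial.eval (coeffs W s) (t * G) ≠ 0 := (hmemW _ x₀).mp hx₀
    rw [map_mul] at htG
    exact ⟨h1, left_ne_zero_of_mul htG, right_ne_zero_of_mul htG⟩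
  -- the fibre of `π` over `s` is `Pm ×_A Spec ℂ` along `a = coeffs W s`
  have Hfib : ∀ s : AlgPoints (base W) ℂ,
      IsPullback (pullback.fst π.left s.left ≫ pullback.fst f W.ι) (pullback.snd π.left s.left) f
        (Spec.map (CommRingCat.ofHom (MvPolynomial.eval (coeffs W s)))) := fun s => by
    rw [← (hpt s).1]
    exact (IsPullback.of_hasPullback π.left s.left).paste_horiz (IsPullback.of_hasPullback f W.ι)
  have h3 : (specOver ℂ ℂ).hom = 𝟙 _ := by
    change Spec.map (CommRingCat.ofHom (RingHom.id ℂ)) = _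
    exact Spec.map_id _
  have h4 : ∀ s : AlgPoints (base W) ℂ, (fiberOver π s).hom = pullback.snd π.left s.left := fun s => by
    rw [fiberOver_hom, h3]
    exact Category.comp_id _
  -- ### (5) `QFamily e`
  haveI : SmoothOfRelativeDimension 2 π.left := ‹SmoothOfRelativeDimension 2 (pullback.snd f W.ι)›
  haveI : GeometricallyIrreducible π.left := ‹GeometricallyIrreducible (pullback.snd f W.ι)›
  haveI : IsProper π.left := inferInstanceAs (IsProper (pullback.snd f W.ι))
  refine ⟨W, 𝒳, π, ?_, ⟨inferInstance, inferInstance, fun s => ?_⟩, ?_, ?_, ?_, ?_⟩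
  · -- (o) the complex point `a₀` of `W`
    let g₀ : Spec (.of ℂ) ⟶ Spec (.of (MvPolynomial (CIdx e) ℂ)) :=
      Spec.map (CommRingCat.ofHom (MvPolynomial.eval a₀))
    have hg₀ : Set.range g₀ ⊆ Set.range W.ι := by
      rintro _ ⟨x, rfl⟩
      rw [Scheme.Opens.range_ι]
      exact (hmemW _ x).mpr ha₀
    obtain ⟨s₀, hs₀⟩ : ∃ s₀ : Spec (.of ℂ) ⟶ (W : Scheme), s₀ ≫ W.ι = g₀ :=
      ⟨_, IsOpenImmersion.lift_fac W.ι g₀ hg₀⟩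
    refine ⟨AlgPoints.mk (X := base W) s₀ ?_⟩
    have hc : (MvPolynomial.eval a₀).comp (algebraMap ℂ (MvPolynomial (CIdx e) ℂ)) = algebraMap ℂ ℂ :=
      RingHom.ext fun r => by simp [MvPolynomial.algebraMap_eq]
    calc s₀ ≫ (base W).hom
        = (s₀ ≫ W.ι) ≫ Spec.map (CommRingCat.ofHom (algebraMap ℂ (MvPolynomial (CIdx e) ℂ))) :=
          (Category.assoc _ _ _).symm
      _ = Spec.map (CommRingCat.ofHom (algebraMap ℂ ℂ)) := by
          rw [hs₀, ← Spec.map_comp, ← CommRingCat.ofHom_comp, hc]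
  · -- (i) the fibre over `s` is a smooth projective geometrically irreducible surface
    refine ⟨?_, ?_, ?_⟩
    · rw [h4]
      haveI := smoothOfRelativeDimension_isStableUnderBaseChange (n := 2)
      exact MorphismProperty.pullback_snd (P := @SmoothOfRelativeDimension 2) _ _ inferInstance
    · letI alg : Algebra (MvPolynomial (CIdx e) ℂ) ℂ := (MvPolynomial.eval (coeffs W s)).toAlgebra
      exact isProjectiveOver_of_isPullback_proj (T := MvPolynomial (CIdx e) ℂ) (L := ℂ) emb hf.symm
        (fiberOver π s) (pullback.fst π.left s.left ≫ pullback.fst f W.ι) (by rw [h4]; exact Hfib s)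
    · rw [h4]
      exact MorphismProperty.pullback_snd (P := @GeometricallyIrreducible) _ _ inferInstance
  · -- (ii) the total space is quasi-projective over `ℂ`: open in `Pm ⊂ ℙᴺ × 𝔸^{CIdx e}`
    obtain ⟨P', j, hP', hj⟩ :=
      isQuasiProjectiveOver_of_proj_over_specOver (k := ℂ) (MvPolynomial (CIdx e) ℂ) f emb hf.symm
    haveI := hj
    let i : 𝒳 ⟶ (Over.mk (f ≫ (specOver ℂ (MvPolynomial (CIdx e) ℂ)).hom) : SchemeOver ℂ) :=
      Over.homMk (pullback.fst f W.ι) (by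
        show pullback.fst f W.ι ≫ f ≫ (specOver ℂ (MvPolynomial (CIdx e) ℂ)).hom =
          pullback.snd f W.ι ≫ W.ι ≫
            Spec.map (CommRingCat.ofHom (algebraMap ℂ (MvPolynomial (CIdx e) ℂ)))
        rw [← Category.assoc, pullback.condition, Category.assoc]
        rfl)
    haveI : IsOpenImmersion i.left := inferInstanceAs (IsOpenImmersion (pullback.fst f W.ι))
    refine ⟨P', i ≫ j, hP', ?_⟩
    rw [Over.comp_left]
    infer_instance
  · -- the base `W` is quasi-projective over `ℂ`: open in `𝔸^{CIdx e}`
    obtain ⟨P', j, hP', hj⟩ := isQuasiProjectiveOver_specOver (k := ℂ) (MvPolynomial (CIdx e) ℂ)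
    haveI := hj
    let i : base W ⟶ specOver ℂ (MvPolynomial (CIdx e) ℂ) := Over.homMk W.ι rfl
    haveI : IsOpenImmersion i.left := inferInstanceAs (IsOpenImmersion W.ι)
    refine ⟨P', i ≫ j, hP', ?_⟩
    rw [Over.comp_left]
    infer_instance
  · -- the base is smooth over `ℂ` of relative dimension `#CIdx e`
    haveI := UniversalHypersurface.smoothOfRelativeDimension_specSpzToSpec ℂ (ι := CIdx e)
    have h : SmoothOfRelativeDimension (0 + Nat.card (CIdx e)) (W.ι ≫
        Spec.map (CommRingCat.ofHom (algebraMap ℂ (MvPolynomial (CIdx e) ℂ)))) := inferInstance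
    rw [Nat.zero_add, Nat.card_eq_fintype_card] at h
    exact h
  · -- (iii) the fibre over `s` is birational over `ℂ` to every hypersurface cut out by the form of `s`
    intro s V hV
    obtain ⟨hs1, hst, hsG⟩ := hpt s
    obtain ⟨hirr, hiso⟩ := hC3 (coeffs W s) hsG
    obtain ⟨eV⟩ := hiso hV
    letI alg : Algebra (MvPolynomial (CIdx e) ℂ) ℂ := (MvPolynomial.eval (coeffs W s)).toAlgebra
    have hunit : IsUnit (algebraMap (MvPolynomial (CIdx e) ℂ) ℂ t) := Ne.isUnit hst
    haveI : IrreducibleSpace ↥(pullback P.hom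
        (Spec.map (CommRingCat.ofHom (algebraMap (MvPolynomial (CIdx e) ℂ) ℂ)))) := hirr
    have hB := Hbir ℂ hunit inferInstance
    -- the fibre of `π` over `s` is `Pm ×_A Spec ℂ`, isomorphic over `Spec ℂ`
    have e₁ : Scheme.BirationalOver (fiberOver π s).hom
        (pullback.snd f (Spec.map (CommRingCat.ofHom (algebraMap (MvPolynomial (CIdx e) ℂ) ℂ)))) := by
      rw [h4]
      exact Scheme.Hom.birationalOver (Hfib s).isoPullback.hom _ _ ((Hfib s).isoPullback_hom_snd)
    -- `P ×_A Spec ℂ ≅ V` over `Spec ℂ` (C3)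
    have e₃ : Scheme.BirationalOver
        (pullback.snd P.hom (Spec.map (CommRingCat.ofHom (algebraMap (MvPolynomial (CIdx e) ℂ) ℂ))))
        V.hom := by
      haveI : IsIso eV.inv.left := (inferInstance : IsIso ((Over.forget _).mapIso eV).inv)
      exact Scheme.Hom.birationalOver eV.inv.left V.hom _ (Over.w eV.inv)
    exact (e₁.trans hB).trans e₃

end Literature.AlgebraicGeometry.HodgeTheory.Q8Family

end
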